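import Summits.BirchSwinnertonDyer.BirchSwinnertonDyer.Theorems.SmallImageMuTransferMuTransferStubX9TheoremASchema
import HarnessLib

/-!
# THEOREM A schema WITH THE TRANSLATE (`stub_coreX9`, crux 19276 `MuTransferX9`): Steps 2–4 may answer
# at a `Γ_ℚ`-translate of Lemma 4's pair

Cell `b2b-bsdres` (X9 prover lineage, GEN 44) serving the K6 route `SmallImageMuTransfer` of cell
`bsd-smallim`. HONEST FRAMING: the cell deletes COMBINATION-SHAPED residual classes of the rank-≤1
BSD formula from PUBLISHED theorems only and TYPES the construction-shaped remainder; this is not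
"finishing BSD"; class X9 stays TYPED at class level. `--supports` helper toward `stub_coreX9` of
stmt-BirchSwinnertonDyer-19276; books nothing, closes nothing; theorems only (no definition, no
named fact).

k6-c2's kernel schema `LevelE.theoremA_contradiction_schema` (p420500) asks, in its hypothesis `hq`,
for the STEP 2–4 data (Chebotarev prime, lifts `k_1`, `c_y(Fr_q)`, unit `U`, reciprocity) AT EVERY
joint value `z ∈ M`.  What the genuine objects deliver (x9 GEN 44 `…X9StepTwoLocal`, p448257) is that
data at the joint value of the DISTINGUISHED local Frobenius of `ℚ_v`, which is a `Γ_ℚ`-TRANSLATE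
`z' = t•z ∈ M` of the prescribed `z` (MU-TRANSFER-PROOF §5 STEP 2: "Another `𝔔` conjugates the pair by
some `g ∈ G` and multiplies `⟨·,·⟩` by `ω(g) ≠ 0`: `ν` depends on `q` only"); and Lemma 4's property
"`C_0 ≠ 0 ∨ C_1 ≠ 0`" passes to the translate (`…X9TranslatePairing`, p448563:
`convCoeff_zero_ne_zero_or_one_ne_zero_iff_modPTwist_smul`).  This file records the corresponding
form of the schema — `theoremA_contradiction_schema_of_translate`: hypothesis `hq` is only asked for
`z` with Lemma 4's property and may answer with the data at ANY `z' ∈ M` having the same property —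
proved by the same three moves (Lemma 4 = `exists_mem_pairingCoeff_ne_zero`; (F7) lowest coefficients;
`step4_contradiction`).  Nothing else changes; the original schema is the case `z' = z` (take
`z' := z` in `hq`).

PARTITION (D-0054): X9 (A4) · X10∧¬Surj (A5) at `p = 3` — hypothesis-discharging helper toward
`stub_coreX9`; closes NONE.

References: HOME/koly/MU-TRANSFER-PROOF.md §5 (STEPS 1–4); K. Kato, Astérisque 295 (2004) §13.3,
Thm. 12.4 [Kato2004Asterisque]; B. Mazur, K. Rubin, Mem. AMS 799 (2004) Prop. 1.3.2, §4.4
[MazurRubin2004].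
-/

-- the summit and its single problem are both named `BirchSwinnertonDyer` (registry layout D-0017)
set_option linter.dupNamespace false

set_option autoImplicit false

namespace Summit.BirchSwinnertonDyer.BirchSwinnertonDyer.Rank1Residual.LevelE

open PowerSeries

variable {k : Type*} [Field k] {V V' : Type*} [AddCommGroup V] [Module k V] [AddCommGroup V']
  [Module k V']

/-- **THEOREM A (MU-TRANSFER-PROOF §5), Steps 1–4 as a kernel schema — form WITH THE TRANSLATE.**
As `theoremA_contradiction_schema`, except that the STEP 2–4 hypothesis `hq` is asked only for joint
values `z ∈ M` with Lemma 4's property (constant or `T¹`-coefficient of `⟨z.1, z.2⟩` non-zero) and may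
deliver the Chebotarev/Kolyvagin/reciprocity data at ANOTHER joint value `z' ∈ M` with the same
property — in the genuine instantiation `z' = t•z`, the joint value of the distinguished local
Frobenius of `ℚ_v` (`…X9StepTwoLocal`), whose Lemma-4 property is that of `z`
(`…X9TranslatePairing`).  These hypotheses are contradictory.
[cite: Kato2004Asterisque, §13.3 and Thm. 12.4 (the inputs 𝐳 and 𝐇¹)] [cite: MazurRubin2004, Prop. 1.3.2 and §4.4] -/
theorem theoremA_contradiction_schema_of_translate (h2 : (2 : k) ≠ 0) {e a ε : ℕ} (he2 : 2 ≤ e)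
    (he : a + ε + 2 ≤ e)
    -- the evaluation pairing `E[p]^*(1) × E[p] → μ_p ≅ 𝔽_p`, non-degenerate
    (ev : V' →ₗ[k] V →ₗ[k] k) (hev : ∃ (y : V') (v : V), ev y v ≠ 0)
    -- STEP 1: the joint-value module of the level-`e` classes, `(T, ι(T))`-stable, both projections onto
    (T : (Fin e → V) →ₗ[k] (Fin e → V)) (D : (Fin e → V') →ₗ[k] (Fin e → V'))
    (hT0 : ∀ x, T x ⟨0, by omega⟩ = 0) (hT1 : ∀ x, T x ⟨1, by omega⟩ = x ⟨0, by omega⟩)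
    (hD0 : ∀ y, D y ⟨0, by omega⟩ = 0) (hD1 : ∀ y, D y ⟨1, by omega⟩ = -y ⟨0, by omega⟩)
    (M : Submodule k ((Fin e → V) × (Fin e → V')))
    (hM : ∀ z ∈ M, (T z.1, D z.2) ∈ M)
    (h1 : ∀ v : V, ∃ z ∈ M, z.1 ⟨0, by omega⟩ = v)
    (h2' : ∀ y : V', ∃ z ∈ M, z.2 ⟨0, by omega⟩ = y)
    -- the Gorenstein pairing `𝒯_J × 𝒯_J^* → A_J ↪ quotients of Ω = k⟦T⟧`, through its two lowest coefficients
    (pair : (Fin (2 * e) → V) → (Fin (2 * e) → V') → k⟦X⟧)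
    (hpair0 : ∀ kk cc, coeff 0 (pair kk cc) = ev (cc ⟨0, by omega⟩) (kk ⟨0, by omega⟩))
    (hpair1 : ∀ kk cc, coeff 1 (pair kk cc) =
      ev (cc ⟨0, by omega⟩) (kk ⟨1, by omega⟩) + ev (cc ⟨1, by omega⟩) (kk ⟨0, by omega⟩))
    -- STEPS 2–4 AT A TRANSLATE: for every joint value with Lemma 4's property, some joint value `z'` with
    -- the same property (the `Γ_ℚ`-translate seen by the distinguished local Frobenius at the Chebotarev
    -- prime `q`) carries the lifts `k_1 = c'(Fr_q)`, `c_y(Fr_q)`, the unit `U` of `κ_q(σ̄) = U T^{e+a} k_1`,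
    -- and reciprocity
    (hq : ∀ z ∈ M, (ev (z.2 ⟨0, by omega⟩) (z.1 ⟨0, by omega⟩) ≠ 0 ∨
        ev (z.2 ⟨0, by omega⟩) (z.1 ⟨1, by omega⟩) + ev (z.2 ⟨1, by omega⟩) (z.1 ⟨0, by omega⟩) ≠ 0) →
      ∃ z' ∈ M, (ev (z'.2 ⟨0, by omega⟩) (z'.1 ⟨0, by omega⟩) ≠ 0 ∨
        ev (z'.2 ⟨0, by omega⟩) (z'.1 ⟨1, by omega⟩) + ev (z'.2 ⟨1, by omega⟩) (z'.1 ⟨0, by omega⟩) ≠ 0) ∧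
        ∃ (k1 : Fin (2 * e) → V) (cy : Fin (2 * e) → V') (U : k⟦X⟧), IsUnit U ∧
          (∀ i : Fin e, k1 ⟨i.val, by omega⟩ = z'.1 i) ∧ (∀ i : Fin e, cy ⟨i.val, by omega⟩ = z'.2 i) ∧
          (X : k⟦X⟧) ^ (2 * e) ∣ X ^ ε * U * X ^ (e + a) * pair k1 cy) :
    False := by
  -- Step 1 + Lemma 4: a joint value pairing with valuation ≤ 1
  obtain ⟨z, hz, hν⟩ := exists_mem_pairingCoeff_ne_zero h2 he2 ev hev T D hT0 hT1 hD0 hD1 M hM h1 h2'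
  -- Steps 2–3 at the translate: the Chebotarev prime and the Kolyvagin class at it
  obtain ⟨z', -, hν', k1, cy, U, hU, hk1, hcy, hrec⟩ := hq z hz hν
  -- (F7): the two lowest coefficients of `⟨k_1, c_y(Fr)⟩_{A_J}` are those of `⟨z'.1, z'.2⟩_{A_e}`
  have hc : ¬ (X : k⟦X⟧) ^ 2 ∣ pair k1 cy := by
    intro hdvd
    have h0 : coeff 0 (pair k1 cy) = 0 := by
      obtain ⟨r, hr⟩ := hdvd
      rw [hr, pow_two, mul_assoc, coeff_zero_X_mul]
    have h1' : coeff 1 (pair k1 cy) = 0 := by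
      obtain ⟨r, hr⟩ := hdvd
      rw [hr, pow_two, mul_assoc, coeff_succ_X_mul, coeff_zero_X_mul]
    rw [hpair0, hcy ⟨0, by omega⟩, hk1 ⟨0, by omega⟩] at h0
    rw [hpair1, hcy ⟨0, by omega⟩, hk1 ⟨1, by omega⟩, hcy ⟨1, by omega⟩, hk1 ⟨0, by omega⟩] at h1'
    rcases hν' with hν0 | hν1
    · exact hν0 h0
    · exact hν1 h1'
  -- Step 4: the count
  exact step4_contradiction hU hc he hrec

end Summit.BirchSwinnertonDyer.BirchSwinnertonDyer.Rank1Residual.LevelE
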